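import Mathlib
import Summits.Ventures.FusionMHD.Models.SAlphaSecondStableS2A45Core0
import HarnessLib

/-!
# STABLE-POINT core at `(2, 9/2)`, piece 11 (`[14, 17]`): kernel-decided Taylor-model leaves ⇒ `F_11 > 0` and `amplitudeResidual 2 (9/2) F_11 F_11″ ≤ 0` on the piece ⇒ `EnergyDominatesOn` for its amplitude phase

LADDER-GRIDFUSION rung F3 («F3.BALLOON-sα-SECOND-STABILITY-S2-A45»: the first certified point on the SECOND-STABILITY side of the s–α model at shear 2 (DIRECTOR RULING 67 (5) class; second-edge bracket at s = 2)); gridfusion-model-7 g10, 2026-08-28 (g8/g9 core lane).  Two `decide +kernel` calls (`OpModel.trig.pLeavesCheck`, scale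
`2^60`, Taylor degree 10, 24 leaves of half-width 1/16) and the lane's soundness theorem `OpSem.trig.pos_of_pLeavesCheck`
(Literature/Analysis/ValidatedNumerics/TaylorModelZeroCert); lit-4's `energyDominatesOn_of_amplitude` (BallooningSAlphaStableSide) turns the two
sign facts into energy domination by `amplitudePhase 2 (9/2) F_11 F_11′` on the piece.  MODELLED: `s–α` model; nothing about a device.
No `native_decide`.  Citations: Freidberg 2014 §12.6.2 (12.97) [Freidberg2014]; Makino–Berz 2003 Alg. 2 [MakinoBerz2003]; Hartman 2002 XI.6.2
[Hartman2002].  Everything here is [instance data].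
-/

open Literature.Analysis.ValidatedNumerics Literature.Analysis.ValidatedNumerics.PolyMP
open Literature.Analysis.ValidatedNumerics.NumericsMP Literature.Analysis.ValidatedNumerics.ExpPoly
open Literature.MathematicalPhysics.MHD.Ballooning
open Real Set

namespace Summit.Ventures.FusionMHD.Models

namespace SAlphaSecondStableS2A45

/-- KERNEL CHECK (residual leaves of piece 11). [instance data] -/
theorem ss245_res11_ok : OpModel.trig.pLeavesCheck ss245Prm (2 ^ 60) (ss245Prog K11 (Poly.deriv (Poly.deriv K11))) [] ss245Leaves11 = true := by
  decide +kernel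

/-- KERNEL CHECK (positivity leaves of piece 11). [instance data] -/
theorem ss245_pos11_ok : OpModel.trig.pLeavesCheck ss245Prm (2 ^ 60) (ss245PosProg K11) [] ss245Leaves11 = true := by
  decide +kernel

/-- The leaves tile `[14, 17]`. [instance data] -/
theorem ss245_tiles11 : tiles (14 : ℚ) (ss245Leaves11.map fun l => (l.e, l.k)) (17 : ℚ) = true := by
  decide +kernel

/-- **PIECE 11**: the phase of `F_11` dominates the `s–α` energy on `[14, 17]` at `(s, α) = (2, 9/2)`. [instance data] -/
theorem ss245_dominates11 :
    SAlpha.EnergyDominatesOn 2 (9 / 2) (SAlpha.amplitudePhase 2 (9 / 2) (Poly.eval K11) (Poly.eval (Poly.deriv K11)))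
      (Icc (14 : ℝ) (17 : ℝ)) := by
  have h := ss245_dominates (lf := K11) (x := 14) (y := 17) (by norm_num) ss245_tiles11 ss245_res11_ok ss245_pos11_ok
  norm_num at h
  exact h

end SAlphaSecondStableS2A45

end Summit.Ventures.FusionMHD.Models
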